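import Summits.HodgeConjecture.HodgeConjecture.Theses.HeckePrymWeil
import Literature.AlgebraicGeometry.Motives.AbelianVarietyProduct

/-!
# Sketch — crux-ideate `stmt-HodgeConjecture-1264` (`SummitOffWeilSector`), ideator 3

First-lemma signatures for the idea card `weil-lefschetz-saturation` (and the finite-group
"quadratic-character criterion" behind its CM component).  Everything here is a `def … : Prop`
(statements only, nothing is asserted); the file must elaborate.
-/

noncomputable section

set_option linter.dupNamespace false
set_option linter.unusedVariables false

open CategoryTheory Complex

namespace Summit.HodgeConjecture.HodgeConjecture.Cruxes.SummitOffWeilSector.WeilLefschetzSaturation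

open Literature.AlgebraicGeometry.Motives Literature.AlgebraicGeometry.HodgeTheory
open Literature.AlgebraicTopology.SingularHomology (cupProduct)
open Summit.HodgeConjecture.HodgeConjecture.Theses.HeckePrymWeil

/-! ## §1 The antecedent of the crux and Weil eigen-spans on arbitrary (B, ψ) -/

/-- The admissible primes of the route: `p ≡ 3 (4)`, `p ≥ 7`. -/
def admissiblePrimes : Set ℕ := {p | p.Prime ∧ p % 4 = 3 ∧ 7 ≤ p}

/-- The complexified Weil span of `(B, ψ)`, `ψ ∘ ψ = -p`, in degree `2k`: the two eigenspaces of
`(𝟙 + ψ)^*` for `(1 ± i√p)^{2k}` (the route's typing of `∧^{2k}H¹_σ ⊕ ∧^{2k}H¹_σ̄`). -/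
def weilEigenSpan (B : AbelianVariety ℂ) (ψ : B ⟶ B) (p k : ℕ) :
    Submodule ℂ (complexBetti B.X (2 * k)) :=
  Module.End.eigenspace (complexBetti.map (𝟙 B + ψ).hom.hom.hom (2 * k)).hom
      ((1 + I * (Real.sqrt (p : ℝ) : ℂ)) ^ (2 * k)) ⊔
    Module.End.eigenspace (complexBetti.map (𝟙 B + ψ).hom.hom.hom (2 * k)).hom
      ((1 - I * (Real.sqrt (p : ℝ) : ℂ)) ^ (2 * k))

/-- The antecedent of the crux (the ℚ(√-p) Hodge–Weil sector), restated with `weilEigenSpan`. -/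
def WeilSector : Prop :=
  ∀ p : ℕ, p.Prime → p % 4 = 3 → 7 ≤ p → ∀ n : ℕ, 1 ≤ n →
    ∀ (A : AbelianVariety ℂ) (φ : A ⟶ A), A.dim = 2 * n → φ ≫ φ = -((p : ℤ) • 𝟙 A) →
      ∀ c : complexBetti A.X (2 * n), IsRationalClass c → IsOfHodgeType (2 * n) A.X (2 * n) n n c →
        c ∈ weilEigenSpan A φ p n → c ∈ algebraicClasses A.X n

/-- Readback: the crux is literally `WeilSector → HodgeConjecture`. -/
theorem summitOffWeilSector_iff : SummitOffWeilSector ↔ (WeilSector → _root_.HodgeConjecture) :=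
  Iff.rfl

/-! ## §2 Weil–Lefschetz generated classes (the LEVER's output side) -/

/-- `WLGen Ps B k c`: the class `c ∈ H^{2k}(B(ℂ); ℂ)` lies in the **Weil–Lefschetz algebra** of the
abelian variety `B` for the set of primes `Ps`: the smallest family of classes, over ALL complex
abelian varieties simultaneously, containing the rational `(1,1)`-classes (divisors, Lefschetz) and
the rational Hodge classes in the Weil span of every `ℚ(√-p)`-structure `ψ` (`ψ ∘ ψ = -p`,
`p ∈ Ps`) in the middle degree, and closed under `ℂ`-linear combinations, cup products and
pull-backs along homomorphisms of abelian varieties (projections, diagonals, addition maps,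
isogenies, endomorphisms — hence Künneth/isotypic projectors and Pontryagin-type operations). -/
inductive WLGen (Ps : Set ℕ) : ∀ (B : AbelianVariety ℂ) (k : ℕ), complexBetti B.X (2 * k) → Prop
  | divisor (B : AbelianVariety ℂ) (d : complexBetti B.X (2 * 1)) :
      IsRationalClass d → IsOfHodgeType B.dim B.X (2 * 1) 1 1 d → WLGen Ps B 1 d
  | weil (B : AbelianVariety ℂ) (ψ : B ⟶ B) (p n : ℕ) (c : complexBetti B.X (2 * n)) :
      p ∈ Ps → B.dim = 2 * n → ψ ≫ ψ = -((p : ℤ) • 𝟙 B) → IsRationalClass c →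
      IsOfHodgeType (2 * n) B.X (2 * n) n n c → c ∈ weilEigenSpan B ψ p n → WLGen Ps B n c
  | zero (B : AbelianVariety ℂ) (k : ℕ) : WLGen Ps B k 0
  | add (B : AbelianVariety ℂ) (k : ℕ) (a b : complexBetti B.X (2 * k)) :
      WLGen Ps B k a → WLGen Ps B k b → WLGen Ps B k (a + b)
  | smul (B : AbelianVariety ℂ) (k : ℕ) (z : ℂ) (a : complexBetti B.X (2 * k)) :
      WLGen Ps B k a → WLGen Ps B k (z • a)
  | cup (B : AbelianVariety ℂ) (l k : ℕ) (a : complexBetti B.X (2 * l)) (b : complexBetti B.X (2 * k)) :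
      WLGen Ps B l a → WLGen Ps B k b → WLGen Ps B (l + k) (cupProduct (show 2 * l + 2 * k = 2 * (l + k) by ring) a b)
  | pullback (B B' : AbelianVariety ℂ) (g : B ⟶ B') (k : ℕ) (c : complexBetti B'.X (2 * k)) :
      WLGen Ps B' k c → WLGen Ps B k ((complexBetti.map g.hom.hom.hom (2 * k)).hom c)

/-- `B` is **`Ps`-Weil–Lefschetz saturated**: every rational Hodge class on `B` (all codimensions) is
Weil–Lefschetz generated.  (The card's SATURATION THEOREM asserts this whenever the Hodge group of
`B` equals its Weil–Lefschetz group `WL_Ps(B)`; for CM `B` this is the quadratic-character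
criterion of §4.) -/
def IsWLSaturated (Ps : Set ℕ) (B : AbelianVariety ℂ) : Prop :=
  ∀ (k : ℕ) (c : complexBetti B.X (2 * k)), IsRationalClass c →
    IsOfHodgeType B.dim B.X (2 * k) k k c → WLGen Ps B k c

/-! ## §3 FIRST LEMMA of the line -/

/-- **First lemma (routine half of the line, provable now modulo Lefschetz (1,1) and functoriality
of `algebraicClasses`):** under the antecedent of the crux, every Weil–Lefschetz generated class
(admissible primes) on every complex abelian variety is algebraic. -/
def FirstLemma : Prop :=
  WeilSector → ∀ (B : AbelianVariety ℂ) (k : ℕ) (c : complexBetti B.X (2 * k)),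
    WLGen admissiblePrimes B k c → c ∈ algebraicClasses B.X k

/-- **The sector the lever converts:** the crux antecedent proves the Hodge conjecture (cycle
conjunct, all codimensions) for every Weil–Lefschetz saturated abelian variety — in particular (by
the saturation theorem) for all powers `Aᵐ` of a general `ℚ(√-p)`-Weil-type `A`, for all powers of a
general type-III abelian variety whose definite quaternion algebra contains `√-p`, and for all
products of CM abelian varieties of admissible quadratic defect. -/
def SaturatedSectorHC : Prop :=
  WeilSector → ∀ (B : AbelianVariety ℂ), IsWLSaturated admissiblePrimes B →
    ∀ (k : ℕ) (c : complexBetti B.X (2 * k)), IsRationalClass c →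
      IsOfHodgeType B.dim B.X (2 * k) k k c → c ∈ algebraicClasses B.X k

/-- `SaturatedSectorHC` is immediate from `FirstLemma` (pure logic). -/
theorem saturatedSectorHC_of_firstLemma (h : FirstLemma) : SaturatedSectorHC :=
  fun hW B hB k c hr hh => h hW B k c (hB k c hr hh)

/-- Saturation is inherited by products only through the generators: a sanity instance of the
closure rules — the pull-back of a generated class along the first projection is generated. -/
theorem WLGen.fst {Ps : Set ℕ} {B B' : AbelianVariety ℂ} {k : ℕ} {c : complexBetti B.X (2 * k)}
    (h : WLGen Ps B k c) :
    WLGen Ps (B.prod B') k ((complexBetti.map (AbelianVariety.fst B B').hom.hom.hom (2 * k)).hom c) :=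
  WLGen.pullback _ _ _ _ _ h

/-! ## §4 The quadratic-character criterion (CM component; finite-group statement) -/

section CMCriterion

open scoped Classical

variable (G : Type*) [Group G] [Fintype G]

/-- `c`-odd part of the indicator of `S ⊆ G` (for a CM type `S`: `1_S - 1/2`). -/
def oddInd (S : Finset G) : G → ℚ := fun x => if x ∈ S then (1 / 2 : ℚ) else (-1 / 2 : ℚ)

/-- `Φ` is a CM type for the central involution `c`: exactly one of `x`, `c x` lies in `Φ`. -/
def IsCMTypeFor (c : G) (Φ : Finset G) : Prop := ∀ x : G, x ∈ Φ ↔ c * x ∉ Φ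

/-- `Φ` is primitive: trivial right stabiliser (Shimura–Taniyama; `A_Φ` simple with `End⁰ = K`). -/
def IsPrimitive (Φ : Finset G) : Prop := ∀ g : G, Φ.image (· * g) = Φ → g = 1

/-- The linear functional `u ↦ Σ_x v(x) u(x)`. -/
def dotLin (v : G → ℚ) : (G → ℚ) →ₗ[ℚ] ℚ := ∑ x : G, v x • LinearMap.proj x

/-- `c`-odd functions `u(cx) = -u(x)` (= `X^*(U_K) ⊗ ℚ`, `U_K` the unitary CM torus). -/
def oddFunctions (c : G) : Submodule ℚ (G → ℚ) :=
  LinearMap.ker (LinearMap.funLeft ℚ ℚ (fun x : G => c * x) + LinearMap.id)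

/-- The DEFECT SPACE `P_Φ^⊥`: `c`-odd functions orthogonal to every Galois (left) translate of the
odd indicator of `Φ` (= characters of `U_K / Hg(A_Φ)`; its dimension is `dim A_Φ - dim Hg(A_Φ)`). -/
def defectSpace (c : G) (Φ : Finset G) : Submodule ℚ (G → ℚ) :=
  oddFunctions G c ⊓ ⨅ g : G, LinearMap.ker (dotLin G (oddInd G (Φ.image (g * ·))))

/-- The `±1`-character of an index-two subgroup `M` (an imaginary quadratic subfield when `c ∉ M`). -/
def quadChar (M : Subgroup G) : G → ℚ := fun x => if x ∈ M then 1 else -1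

/-- **Quadratic defect** relative to a family `Ms` of index-two subgroups not containing `c`
(the admissible imaginary quadratic subfields): the defect space is spanned by the characters
`χ_M`, `M ∈ Ms`, that it contains (the `Φ`-balanced, i.e. Weil-type, ones).  By the card's torus
computation this is EQUIVALENT to: all Hodge classes on all powers of `A_Φ` are generated by
divisor classes and Weil classes of the imaginary quadratic subfields in `Ms`. -/
def QuadraticDefect (c : G) (Φ : Finset G) (Ms : Set (Subgroup G)) : Prop :=
  defectSpace G c Φ ≤ Submodule.span ℚ
    {χ | ∃ M ∈ Ms, M.index = 2 ∧ c ∉ M ∧ χ = quadChar G M ∧ χ ∈ defectSpace G c Φ}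

end CMCriterion

/-- **Census fact 1 (job j011109, hand-checked): NON-quadratic defect exists.**  For
`G = ℤ/18` (CM fields `K = k·F`, `F` real cyclic of degree 9), complex conjugation `c = 9`, there is a
primitive CM type with non-zero defect not spanned by quadratic characters: imaginary-quadratic
Weil classes + divisors do NOT generate the Hodge ring of the powers of the simple CM 9-fold `A_Φ`
(André's CM-field Weil classes are genuinely needed there). -/
def CensusC18 : Prop :=
  ∃ Φ : Finset (Multiplicative (ZMod 18)),
    IsCMTypeFor _ (Multiplicative.ofAdd 9) Φ ∧ IsPrimitive _ Φ ∧
      defectSpace _ (Multiplicative.ofAdd 9) Φ ≠ ⊥ ∧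
        ¬ QuadraticDefect _ (Multiplicative.ofAdd 9) Φ Set.univ

/-- **Census fact 2 (job j011109, hand-checked): quadratic defect is the rule in degree 12.**  For
`G = ℤ/6 × ℤ/2` with `c = (0,1)` (e.g. `ℚ(ζ₂₁)`), every primitive CM type has quadratic defect:
the exceptional Hodge classes on powers of these simple CM sixfolds are generated by divisors and
the Weil classes of the imaginary quadratic subfields (`ℚ(√-3)`, `ℚ(√-7)` for `ℚ(ζ₂₁)`). -/
def CensusC6xC2 : Prop :=
  ∀ Φ : Finset (Multiplicative (ZMod 6 × ZMod 2)),
    IsCMTypeFor _ (Multiplicative.ofAdd (0, 1)) Φ → IsPrimitive _ Φ →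
      QuadraticDefect _ (Multiplicative.ofAdd (0, 1)) Φ Set.univ

end Summit.HodgeConjecture.HodgeConjecture.Cruxes.SummitOffWeilSector.WeilLefschetzSaturation

end
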